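import Summits.AtomisticToContinuum.Crystallization.Theorems.FrustratedLawDichotomyStrainedPatchSoftSplit
import Summits.AtomisticToContinuum.Crystallization.Theorems.FrustratedLawDichotomyStrainedPatchForceCap

/-!
# Strained patch — «KernelCut»: the STIFF pair bridge (T)/(D_GB⋆) cut into  BALANCED REFIT ∧ ROW ENCLOSURE ∧ PAIR-KERNEL CERTIFICATE

decomp-a2c lens-5 g86 NODE (crux `AperiodicFrustratedLawGap`, stmt-AtomisticToContinuum-27623, T-side [CORE-FAR] `CoreOffTubeFloor (63/10) (63/10) ρ ε 0`,
route (F) `ρ = 26/5`; lens «finite/base range + asymptotic regime + bridge»).  Imports the landed g85 node `…StrainedPatchSoftSplit` (p854059/65/71: (T)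
`RefineGBS`, (S) `SoftEnvelope`, (K_S) `FamilyCoverGS`, the record seams) and the landed g58 `…StrainedPatchForceCap` (`forceCapOne : ForceCapLaw σ₁` PROVED;
it imports g57 `…StrainedPatchQuantSlaving`: the force tables `hessBlk0`/`force0`, `linForce`, the inflated linear force rows `InForcePolytope κ σ H F X`).

THE LEAF.  After g85 the undecided analytic far T-leaf of record is the STIFF PAIR BRIDGE (T) `RefineGBS 𝓘₀ 𝓘 𝓥 ρ ε η₂ τ₀ T₀ τ T B` (= (D_GB⋆) `RefineGB …` at
`𝓥 = zeroModes`): an admissible clean mono-phase far-class good-centred cluster GRADED-charted by a coarse host (`τ₀ = 1/25`) is, modulo an isometry and a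
soft field `v ∈ 𝓥`, GB-charted at the host-graded PAIR CONE `B` (FZ09 `197/10000 + 49/5000·ℓ`, FZ62 `131/10000 + 131/20000·ℓ`, HM62 flat `239/10000`).  The
mechanism everybody names is «coercive interior regularity of the equilibrium residual».  This node TYPES that mechanism as three pieces whose conjunction
PROVABLY gives (T) — every family, mode family, balance predicate, radius, tables — and says exactly where its finite range must reach:

* ★ **(R) `BalancedRefit 𝓘₀ 𝓘 𝓑 ρ ε η₂ τ₀ T₀ τ₁ T₁`** [KINEMATIC] — every coarse graded chart by `𝓘₀` of such a cluster can be replaced, modulo a linear isometry,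
  by a graded chart by `𝓘` at `(τ₁, T₁)` satisfying the BALANCE predicate `𝓑` (designated: `rotBalanced r` = the normal equations of the least-squares ROTATION fit
  on the `r`-ball; `balTop` = no balance).  `balTop`, `𝓘₀ ≤ 𝓘`, `τ₁ = τ₀`: PROVED (`balancedRefit_top`).  `rotBalanced`, `τ₁ = 4τ₀`: ATTACKABLE · KNOWN-MATH
  (SO(3) compact ⇒ a least-squares minimiser exists; its first-order condition along `so(3)` IS `rotBalanced`; rms comparison with the given chart bounds the
  rotation angle by `2τ₀/r_rms`, whence sup `≤ τ₀ + 2τ₀·(63/10)/r_rms < 4τ₀`).  `rotBalanced`, `τ₁ = τ₀`: UNDECIDED · INSTRUMENTABLE «BAL-86» (post-balance sup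
  on the census clusters).  WHY (R) IS LOAD-BEARING (§5 toy `stencil_pair_sum_eq_zero`): rigid rotations and homogeneous strains are INVISIBLE to the linearised
  force rows of a centrosymmetric host (odd stencil moments vanish), so nothing but the refit bounds them; an un-balanced `1/25`-chart may carry a rotation
  `θ ≈ (1/25)/(63/10)` whose pair signal `θ·ℓ ≈ 0.0063·ℓ` alone exhausts the FZ62 cone slope `131/20000` and the flat HM62 cone at `ℓ ≥ 3.8`.
* ★★ **(E) `SlavingEnclosureG 𝓘 𝓑 ρ ε η₂ τ₁ T₁ κ σ H F X`** [ANALYTIC — the REGIME statement] — the deviation field of every admissible clean mono-phase far-class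
  good-centred cluster graded-charted by `𝓘` at `(τ₁, T₁)` and balanced lies in the `κ`-INFLATED LINEAR FORCE POLYTOPE `InForcePolytope κ σ H F X` of g57
  (`‖F(e a) + Σ H(e a, e a') dev a'‖ ≤ (1+κ)σ + X(e a)` at every reach site).  = g57 (ENC κ) transplanted from `ChartBy`/`FineChart` to graded charts.
  A-PRIORI VERSION PROVED: (FC σ) [tree `forceCapOne`, σ = σ₁] ∧ (TFR-G κσ) `ForceTaylorBoundG` [KNOWN-MATH · ATTACKABLE: Taylor of the pair force on the
  `τ₁`-tube, crude constants] ⟹ (E) (`slavingEnclosureG_of_forceCap`); monotone in `κ`.  UNDECIDED at a USEFUL `κ`: structure-free `κσ₁ ≈` (½·L·d)·(2τ₁)² per row is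
  `≫ σ₁`; on ADMISSIBLE clusters neighbour differences are `≈ 1/100` and `κ_E ≈ 7` (memo §2) — the structured remainder (g57 chain) or direct measurement
  «KAPPA-86» decides.
* ★★ **(P) `PairKernelCertS 𝓘 𝓑 𝓥 τ₁ T₁ κ σ H F X τ T B`** [INSTRUMENTABLE — the FINITE RANGE: one parametric LP family per host class, NO admissibility] — every
  graded chart by a host of `𝓘` at `(τ₁, T₁)`, balanced, with deviation field in the inflated polytope, is soft-correctedly GB-charted at `(τ, T, B)` for some
  `v ∈ 𝓥(host)` (at `𝓥 = zeroModes`: plainly GB-charted, `PairKernelCert`).  Per host this is the inclusion (coarse box ∩ balance ∩ inflated rows) ⊆ (fine site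
  boxes ∩ pair cones): finitely many LPs; the LP DUAL multipliers `y` of the pair functional `⟨ν, dev a − dev b⟩` solve the ADJOINT (discrete Green's function)
  problem `Hᵀy = ν(δ_a − δ_b)` on the informative interior, and the LP value is  τ₁·κ₁(a,b) + ((1+κ)σ + X)·κ₂(a,b)  with the KERNEL CONSTANTS
  `κ₁ = Σ_{rim} ‖(Hᵀy)_∂‖` (boundary leakage of the discrete harmonic extension) and `κ₂ = Σ_{interior} ‖y‖` (Green mass) — the census table «KERNEL-86».
  Antitone in `κ`.

THE SEAM (PROVED, `refineGBS_of_kernelCut`): (R) ∧ (E) ∧ (P) ⟹ (T); at `zeroModes` (D_GB) `refineGB_of_kernelCut`; the record instances `refineGBRecByAt_of_kernelCut`,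
`coreOff_26_5_of_kernelCut` (through the tree's `coreOff_26_5_of_pairTubeRecBy`), the soft record `refineGBRecByAt_of_kernelCutS` (through g85's
`refineGBRecByAt_of_softSplit`), and the RIM-LOOSE record `coreOff_of_kernelCut_rimCone` (§3).

THE LENS READING — WHERE THE FINITE RANGE MUST REACH (memo §2, the node's quantitative content).  The bridge is the pair of monotonicities in `κ`
(`slavingEnclosureG_mono_kappa`, `pairKernelCertS_anti_kappa`): it BITES iff `κ_E(class) ≤ κ_P(class, pair)`.  Two regimes of pairs:
(i) INNER pairs (both host endpoints within `R_in` of the centre): after affine balance the boundary leakage is carried by the un-absorbed harmonic modes of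
degree `k ≥ 2`, `τ₁κ₁ ≈ τ₁·k·(R_in/R)^{k-1}·ℓ/R` (`≈ 0.002–0.005` at `R_in = 2`, `R = 63/10`), and the Green term is `(1+κ)σ₁κ₂` with `κ₂ ≈ 0.15` per unit pair
(continuum dipole estimate) ⇒ the nearest-neighbour cone is met iff `κ ≲ 9` (FZ62) / `12` (HM62) / `16` (FZ09) against `κ_E ≈ 7`: a NARROW BUT NON-EMPTY window —
the instrument decides.  (ii) RIM pairs (an endpoint in the collar `R_in < r ≤ 63/10`; relevant pairs reach `r = 2 + 9/2`): Cauchy–Born-EQUILIBRATED polynomial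
fields of degree `≤ 3` are EXACTLY row-invisible at interior sites of a centrosymmetric host (second stencil moment = the CB operator, odd moments vanish,
fourth moments vanish on cubics; on hcp-centred hosts, and in general, the row-invisible fields are the DISCRETE-HARMONIC ones `H_II u_I = −H_I∂ u_∂`, a space
as large as the collar, containing the smooth degree-2-type data below), so on such a field the polytope information is void and only the coarse box and the
family's bend span bound it: a
non-family equilibrated quadratic of rim amplitude `τ₀ = 1/25` has rim-pair oscillation `≈ τ₀(1 − (2/6.3)²) ≈ 0.036` — INSIDE the FZ09 cone at `ℓ = 4.3`
(`0.062`), AT the FZ62 cone (`0.041`), and BEYOND the flat HM62 cone (`0.0239`).  Hence: (P) at the record table is predicted to FAIL on HM62-class rim pairs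
for every `κ ≥ 0` («BEND-86», the cheapest falsifier, also a falsifier of (D_GB⋆) ITSELF on that class if the bent cluster is admissible and far-class), and the
node pre-types the repair: the RADIUS-GRADED cone `rimConeBy R_in βf sf βr sr τ₀` (§3: record cone on inner relevant pairs, a looser cone on relevant pairs
touching the collar, `2τ₀` elsewhere), monotone from `relConeBy` (`pairLE_relConeBy_rimConeBy`), with the record `coreOff_of_kernelCut_rimCone` whose E-cell
`TubeFloorGB 𝓘 (1/25) (constTol (1/25)) (rimConeBy …)` is the census re-certification «RIMLOOSE-86».  RESIDUAL of the node = (P) on rim pairs at whatever cone the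
E-cells can afford there ((ii) is kinematic, not analytic: the collar's oscillation is bounded only by the coarse box and the bend span of the family), and
(E) at `κ ≤ κ_P` (structured remainder).

STRENGTH TAGS (doctrine (a)).  (R): KINEMATIC · WEAKER (does not mention forces or cones; `balTop` instance PROVED; `rotBalanced` ATTACKABLE/INSTRUMENTABLE as
above).  (E): ANALYTIC · UNDECIDED at useful `κ` · not known to imply (T) (says nothing about pair cones) · a-priori version PROVED.  (P): INSTRUMENTABLE ·
WEAKER (no admissibility; a per-host finite-dimensional inclusion; cannot give (T) without (E): MustFail86) · predicted PASS on inner pairs in the window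
`κ ∈ [κ_E, κ_P]`, FAIL on HM62 rim pairs at the record table (BEND-86) — stated test.  No piece is an EQUIV of (T); no piece is known to imply [CORE-FAR] or the
summit.  WHY NOVEL (w.r.t. g57 «QuantSlaving», g81 «CoverBridge», g84 «PairTube», g85 «SoftSplit»): g57 certified the SCORE functional over the force polytope
in SITE currency and had no refit; here the certified functionals are the PAIR differences of the record cones, the refit's BALANCE is a typed, load-bearing
piece (the row-invisible affine modes), the cut is parametric in the soft family `𝓥` of g85 (the LP runs on the stiff quotient), and the rim/inner split of
the pair table with its kinematic obstruction (row-invisible equilibrated polynomials) is new.  0 sorry · no new axiom · no `instance` · no `notation`.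
-/

open scoped BigOperators Classical
open Literature.Analysis.ValidatedNumerics.Numerics (SC)
open Summit.AtomisticToContinuum.Crystallization.Theorems.ChargedEnergyGapNegative (eStar E3)
open Summit.AtomisticToContinuum.Crystallization.Theorems.FrustratedLawDichotomyRangeCut
open Summit.AtomisticToContinuum.Crystallization.Theorems.FrustratedLawDichotomySchurCut
open Summit.AtomisticToContinuum.Crystallization.Theorems.FrustratedLawDichotomyMotifLemmas (GoodAtScale)
open Summit.AtomisticToContinuum.Crystallization.Theorems.FrustratedLawDichotomyAveragingCut (ballAvg)
open Summit.AtomisticToContinuum.Crystallization.Theorems.FrustratedLawDichotomyExemptLocOpt (LocOptFails)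
open Summit.AtomisticToContinuum.Crystallization.Theorems.FrustratedLawDichotomyExemptSplit (SchurElasticPricingX)
open Summit.AtomisticToContinuum.Crystallization.Theorems.FrustratedLawDichotomyExemptAbsorptionRecord
open Summit.AtomisticToContinuum.Crystallization.Theorems.FrustratedLawDichotomyCollarCensus
open Summit.AtomisticToContinuum.Crystallization.Theorems.FrustratedLawDichotomyCollarCensusKappa
open Summit.AtomisticToContinuum.Crystallization.Theorems.FrustratedLawDichotomyStrainedPatchHomSplit
open Summit.AtomisticToContinuum.Crystallization.Theorems.FrustratedLawDichotomyStrainedPatchCleanCollar (CleanBall TailPenalty AnnularDefectFloor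
  DefectiveCollarFloor tailOut)
open Summit.AtomisticToContinuum.Crystallization.Theorems.FrustratedLawDichotomyStrainedPatchPhaseCut (MonoPhaseBall AnnularPhaseFloor PolyTextureFloor
  monoPhaseBall_comp_iff FccGoodAtScale)
open Summit.AtomisticToContinuum.Crystallization.Theorems.FrustratedLawDichotomyStrainedPatchCoreTube (NearHomIsoAt CoreOffTubeFloor RimOffTubeFloor nearHomIsoAt_comp_iff)
open Summit.AtomisticToContinuum.Crystallization.Theorems.FrustratedLawDichotomyStrainedPatchCoreTubeRecord (CoreCoreRelief)
open Summit.AtomisticToContinuum.Crystallization.Theorems.FrustratedLawDichotomyStrainedPatchStrainBands (EdgeFarFloor coreOff_iff_edge_and_soft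
  softFarFloor_eighth)
open Summit.AtomisticToContinuum.Crystallization.Theorems.FrustratedLawDichotomyStrainedPatchHomIsometry (admissible_comp_iff goodAtScale_comp_iff
  dist_comp injective_comp_iff)
open Summit.AtomisticToContinuum.Crystallization.Theorems.FrustratedLawDichotomyStrainedPatchHomTubeIso (cleanBall_comp_iff ballAvg_xRec_comp)
open Summit.AtomisticToContinuum.Crystallization.Theorems.FrustratedLawDichotomyStrainedPatchChartFamilies (ChartBy FamilyLE familyLE_refl
  ChartBy.mono_t ChartBy.mono_family)
open Summit.AtomisticToContinuum.Crystallization.Theorems.FrustratedLawDichotomyStrainedPatchHostCells (TubeFloor FamilyCover FamP)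
open Summit.AtomisticToContinuum.Crystallization.Theorems.FrustratedLawDichotomyStrainedPatchQuantSlaving (ChartFam SlackTab)
open Summit.AtomisticToContinuum.Crystallization.Theorems.FrustratedLawDichotomyStrainedPatchGradedTube
open Summit.AtomisticToContinuum.Crystallization.Theorems.FrustratedLawDichotomyStrainedPatchCoverBridge
open Summit.AtomisticToContinuum.Crystallization.Theorems.FrustratedLawDichotomyStrainedPatchPairTube
open Summit.AtomisticToContinuum.Crystallization.Theorems.FrustratedLawDichotomyStrainedPatchHomCertTree (CertTree treeOK)
open Summit.AtomisticToContinuum.Crystallization.Theorems.FrustratedLawDichotomyStrainedPatchHomEntryGram (rootC rootW)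
open Summit.AtomisticToContinuum.Crystallization.Theorems.FrustratedLawDichotomyStrainedPatchHomEntryGramHcp (rootCH rootWH)
open Summit.AtomisticToContinuum.Crystallization.Theorems.FrustratedLawDichotomyStrainedPatchHomEntryLeafHT (entryLeafOK6RBKP4 semOKH)
open Summit.AtomisticToContinuum.Crystallization.Theorems.FrustratedLawDichotomyAperiodicGapRecordJunctionHomFloorF6p
open Summit.AtomisticToContinuum.Crystallization.Theorems.FrustratedLawDichotomyAperiodicGapRecordJunctionHomFloorGraded
open Summit.AtomisticToContinuum.Crystallization.Theorems.FrustratedLawDichotomyStrainedPatchQuantSlaving (HessTab ForceTab InForcePolytope linForce IsReach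
  ForceCapLaw ForceCapOne siteForce norm_lin_le_of_cap_of_rem inForcePolytope_mono hessBlk0 force0)
open Summit.AtomisticToContinuum.Crystallization.Theorems.FrustratedLawDichotomyStrainedPatchEnvelopeLaw (dev)
open Summit.AtomisticToContinuum.Crystallization.Theorems.FrustratedLawDichotomyAveragingCut (ball)
open Summit.AtomisticToContinuum.Crystallization.Theorems.FrustratedLawDichotomyStrainedPatchForceCap (forceCapOne forceCapLaw_of_le)
open Summit.AtomisticToContinuum.Crystallization.Theorems.FrustratedLawDichotomyAperiodicGapRecordJunctionHomFloorF6pT26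
open Summit.AtomisticToContinuum.Crystallization.Theorems.FrustratedLawDichotomyStrainedPatchSoftSplit

namespace Summit.AtomisticToContinuum.Crystallization.Theorems.FrustratedLawDichotomyStrainedPatchKernelCut

/-! ## §0. Balance predicates -/

/-- A BALANCE PREDICATE on charts `(M, z, c; M₀, z₀, c₀, e)` — which normal equations the refit satisfies. -/
abbrev BalPred : Type := (M : ℕ) → (Fin M → E3) → Fin M → (M₀ : ℕ) → (Fin M₀ → E3) → Fin M₀ → (Fin M → Fin M₀) → Prop

/-- No balance. -/
def balTop : BalPred := fun _ _ _ _ _ _ _ => True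

/-- ★ `rotBalanced r` — the chart is a CRITICAL POINT OF THE LEAST-SQUARES ROTATION FIT on the `r`-ball: for every skew-adjoint `A` (an element of `so(3)`),
`Σ_{a ∈ B(c,r)} ⟨dev a, A (z₀ (e a) − z₀ c₀)⟩ = 0` (the derivative at `t = 0` of `Σ ‖exp(tA)(z a − z c) − (z₀ (e a) − z₀ c₀)‖²`, using `⟨A x, x⟩ = 0`).
The designated balance of the node; the census's refit (rotation + class-preserving strain, labels kept) satisfies it. -/
def rotBalanced (r : ℝ) : BalPred := fun _ z c _ z₀ c₀ e =>
  ∀ A : E3 →ₗ[ℝ] E3, (∀ x y : E3, inner ℝ (A x) y = -inner ℝ x (A y)) → ∑ a ∈ ball r z c, inner ℝ (dev z c z₀ c₀ e a) (A (z₀ (e a) - z₀ c₀)) = 0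

/-- `BalLE 𝓑 𝓑'` — `𝓑` is at least as demanding as `𝓑'`. -/
def BalLE (𝓑 𝓑' : BalPred) : Prop :=
  ∀ (M : ℕ) (z : Fin M → E3) (c : Fin M) (M₀ : ℕ) (z₀ : Fin M₀ → E3) (c₀ : Fin M₀) (e : Fin M → Fin M₀), 𝓑 M z c M₀ z₀ c₀ e → 𝓑' M z c M₀ z₀ c₀ e

/-- Every balance refines `balTop`. [formal bookkeeping] -/
theorem balLE_top (𝓑 : BalPred) : BalLE 𝓑 balTop := fun _ _ _ _ _ _ _ _ => trivial

/-! ## §1. The three pieces -/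

/-- ★ **(R) `BalancedRefit 𝓘₀ 𝓘 𝓑 ρ ε η₂ τ₀ T₀ τ₁ T₁`** [KINEMATIC] — every admissible, `63/10`-clean, `63/10`-mono-phase, far-class, `η₂`-good-centred cluster
graded-charted by the coarse family `𝓘₀` at `(τ₀, T₀)` is, modulo a linear isometry, graded-charted by `𝓘` at `(τ₁, T₁)` with balance `𝓑`.
(`= Refine 𝓘₀ 𝓘 ρ ε η₂ τ₀ T₀ τ₁ T₁` ∧ balance; `balancedRefit_top`: PROVED at `balTop`, `𝓘₀ ≤ 𝓘`, `(τ₁, T₁) = (τ₀, T₀)`.) -/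
def BalancedRefit (𝓘₀ 𝓘 : ChartFam) (𝓑 : BalPred) (ρ ε η₂ τ₀ : ℝ) (T₀ : SlackTab) (τ₁ : ℝ) (T₁ : SlackTab) : Prop :=
  ∀ (M : ℕ) (z : Fin M → E3) (c : Fin M) (M₀ : ℕ) (z₀ : Fin M₀ → E3) (c₀ : Fin M₀) (e : Fin M → Fin M₀),
    Admissible M z c → CleanBall (63 / 10) z c → MonoPhaseBall (63 / 10) z c → ¬NearHomIsoAt ρ ε z c → GoodAtScale η₂ (3 / 2) z c →
      ChartByG 𝓘₀ τ₀ T₀ z c z₀ c₀ e →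
        ∃ (R : E3 ≃ₗᵢ[ℝ] E3) (M₁ : ℕ) (z₁ : Fin M₁ → E3) (c₁ : Fin M₁) (e₁ : Fin M → Fin M₁),
          ChartByG 𝓘 τ₁ T₁ (⇑R ∘ z) c z₁ c₁ e₁ ∧ 𝓑 M (⇑R ∘ z) c M₁ z₁ c₁ e₁

/-- ★ **(TFR-G ρ) `ForceTaylorBoundG 𝓘 𝓑 ρ ε η₂ τ₁ T₁ ϱ H F X`** [KNOWN-MATH · ATTACKABLE (L)] — on balanced graded `(τ₁, T₁)`-charts of admissible clean mono-phase
far-class good-centred clusters the TRUE move-test force at a reach site differs from its linearisation through the tables by at most `ϱ + X(e a)`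
(= g57 `ForceTaylorBound` on graded charts). -/
def ForceTaylorBoundG (𝓘 : ChartFam) (𝓑 : BalPred) (ρ ε η₂ τ₁ : ℝ) (T₁ : SlackTab) (ϱ : ℝ) (H : HessTab) (F : ForceTab) (X : SlackTab) : Prop :=
  ∀ (M : ℕ) (z : Fin M → E3) (c : Fin M) (M₀ : ℕ) (z₀ : Fin M₀ → E3) (c₀ : Fin M₀) (e : Fin M → Fin M₀),
    Admissible M z c → CleanBall (63 / 10) z c → MonoPhaseBall (63 / 10) z c → ¬NearHomIsoAt ρ ε z c → GoodAtScale η₂ (3 / 2) z c →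
      ChartByG 𝓘 τ₁ T₁ z c z₀ c₀ e → 𝓑 M z c M₀ z₀ c₀ e →
        ∀ a ∈ ball (63 / 10) z c, IsReach z c a → ‖siteForce 7 z a - linForce H F z c z₀ c₀ e a‖ ≤ ϱ + X M₀ z₀ c₀ (e a)

/-- ★★ **(E) `SlavingEnclosureG 𝓘 𝓑 ρ ε η₂ τ₁ T₁ κ σ H F X`** [ANALYTIC — the regime statement · UNDECIDED at useful `κ`] — the deviation field of every balanced graded
`(τ₁, T₁)`-chart by `𝓘` of an admissible clean mono-phase far-class good-centred cluster lies in the `κ`-inflated linear force polytope. -/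
def SlavingEnclosureG (𝓘 : ChartFam) (𝓑 : BalPred) (ρ ε η₂ τ₁ : ℝ) (T₁ : SlackTab) (κ σ : ℝ) (H : HessTab) (F : ForceTab) (X : SlackTab) : Prop :=
  ∀ (M : ℕ) (z : Fin M → E3) (c : Fin M) (M₀ : ℕ) (z₀ : Fin M₀ → E3) (c₀ : Fin M₀) (e : Fin M → Fin M₀),
    Admissible M z c → CleanBall (63 / 10) z c → MonoPhaseBall (63 / 10) z c → ¬NearHomIsoAt ρ ε z c → GoodAtScale η₂ (3 / 2) z c →
      ChartByG 𝓘 τ₁ T₁ z c z₀ c₀ e → 𝓑 M z c M₀ z₀ c₀ e → InForcePolytope κ σ H F X z c z₀ c₀ e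

/-- ★★ **(P) `PairKernelCertS 𝓘 𝓑 𝓥 τ₁ T₁ κ σ H F X τ T B`** [INSTRUMENTABLE — per host a finite-dimensional inclusion; NO admissibility] — every balanced graded
`(τ₁, T₁)`-chart by a host of `𝓘` whose deviation field lies in the inflated polytope is soft-correctedly GB-charted at `(τ, T, B)` for some `v ∈ 𝓥(host)`. -/
def PairKernelCertS (𝓘 : ChartFam) (𝓑 : BalPred) (𝓥 : ModeFam) (τ₁ : ℝ) (T₁ : SlackTab) (κ σ : ℝ) (H : HessTab) (F : ForceTab) (X : SlackTab)
    (τ : ℝ) (T : SlackTab) (B : PairTab) : Prop :=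
  ∀ (M : ℕ) (z : Fin M → E3) (c : Fin M) (M₀ : ℕ) (z₀ : Fin M₀ → E3) (c₀ : Fin M₀) (e : Fin M → Fin M₀),
    ChartByG 𝓘 τ₁ T₁ z c z₀ c₀ e → 𝓑 M z c M₀ z₀ c₀ e → InForcePolytope κ σ H F X z c z₀ c₀ e →
      ∃ v : Fin M₀ → E3, 𝓥 M₀ z₀ c₀ v ∧ ChartByGBS 𝓘 τ T B z c z₀ c₀ e v

/-- ★★ **(P₀) `PairKernelCert 𝓘 𝓑 τ₁ T₁ κ σ H F X τ T B`** — the zero-mode form: the conclusion is the plain GB-chart `ChartByGB 𝓘 τ T B`. -/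
def PairKernelCert (𝓘 : ChartFam) (𝓑 : BalPred) (τ₁ : ℝ) (T₁ : SlackTab) (κ σ : ℝ) (H : HessTab) (F : ForceTab) (X : SlackTab)
    (τ : ℝ) (T : SlackTab) (B : PairTab) : Prop :=
  ∀ (M : ℕ) (z : Fin M → E3) (c : Fin M) (M₀ : ℕ) (z₀ : Fin M₀ → E3) (c₀ : Fin M₀) (e : Fin M → Fin M₀),
    ChartByG 𝓘 τ₁ T₁ z c z₀ c₀ e → 𝓑 M z c M₀ z₀ c₀ e → InForcePolytope κ σ H F X z c z₀ c₀ e → ChartByGB 𝓘 τ T B z c z₀ c₀ e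

/-! ## §2. Seams -/

section Seams

variable {𝓘₀ 𝓘 𝓘' : ChartFam} {𝓑 𝓑' : BalPred} {𝓥 𝓥' : ModeFam} {ρ ε η₂ τ₀ τ₁ τ κ κ' σ ϱ : ℝ} {T₀ T₁ T : SlackTab} {B B' : PairTab}
  {H : HessTab} {F : ForceTab} {X : SlackTab}

/-- ★ (FC σ) ∧ (TFR-G κσ) ⟹ (E): the A-PRIORI enclosure on graded charts (g57's triangle step). [folklore] -/
theorem slavingEnclosureG_of_forceCap (hF : ForceCapLaw σ) (hT : ForceTaylorBoundG 𝓘 𝓑 ρ ε η₂ τ₁ T₁ (κ * σ) H F X) :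
    SlavingEnclosureG 𝓘 𝓑 ρ ε η₂ τ₁ T₁ κ σ H F X := by
  intro M z c M₀ z₀ c₀ e hz hcl hm hn hg hch hb a ha hr
  have h := norm_lin_le_of_cap_of_rem (hF M z c hz a hr) (hT M z c M₀ z₀ c₀ e hz hcl hm hn hg hch hb a ha hr)
  linarith

/-- ★ … with the force cap of record DISCHARGED (`forceCapOne`, tree): (TFR-G κσ₁) ⟹ (E) at `σ₁`. [folklore] -/
theorem slavingEnclosureG_of_taylor (hT : ForceTaylorBoundG 𝓘 𝓑 ρ ε η₂ τ₁ T₁ (κ * sigmaOne) H F X) :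
    SlavingEnclosureG 𝓘 𝓑 ρ ε η₂ τ₁ T₁ κ sigmaOne H F X :=
  slavingEnclosureG_of_forceCap forceCapOne hT

/-- (E) is MONOTONE in `κ` (the bridge, analytic side). [formal bookkeeping] -/
theorem slavingEnclosureG_mono_kappa (hκ : κ ≤ κ') (hσ : 0 ≤ σ) (h : SlavingEnclosureG 𝓘 𝓑 ρ ε η₂ τ₁ T₁ κ σ H F X) :
    SlavingEnclosureG 𝓘 𝓑 ρ ε η₂ τ₁ T₁ κ' σ H F X :=
  fun M z c M₀ z₀ c₀ e hz hcl hm hn hg hch hb => inForcePolytope_mono hκ hσ (h M z c M₀ z₀ c₀ e hz hcl hm hn hg hch hb)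

/-- (E) is ANTITONE in the balance (more balance, fewer charts). [formal bookkeeping] -/
theorem slavingEnclosureG_anti_bal (hle : BalLE 𝓑 𝓑') (h : SlavingEnclosureG 𝓘 𝓑' ρ ε η₂ τ₁ T₁ κ σ H F X) :
    SlavingEnclosureG 𝓘 𝓑 ρ ε η₂ τ₁ T₁ κ σ H F X :=
  fun M z c M₀ z₀ c₀ e hz hcl hm hn hg hch hb => h M z c M₀ z₀ c₀ e hz hcl hm hn hg hch (hle M z c M₀ z₀ c₀ e hb)

/-- (P) is ANTITONE in `κ` (the bridge, certificate side). [formal bookkeeping] -/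
theorem pairKernelCertS_anti_kappa (hκ : κ ≤ κ') (hσ : 0 ≤ σ) (h : PairKernelCertS 𝓘 𝓑 𝓥 τ₁ T₁ κ' σ H F X τ T B) :
    PairKernelCertS 𝓘 𝓑 𝓥 τ₁ T₁ κ σ H F X τ T B :=
  fun M z c M₀ z₀ c₀ e hch hb hP => h M z c M₀ z₀ c₀ e hch hb (inForcePolytope_mono hκ hσ hP)

/-- (P) is ANTITONE in the balance. [formal bookkeeping] -/
theorem pairKernelCertS_anti_bal (hle : BalLE 𝓑 𝓑') (h : PairKernelCertS 𝓘 𝓑' 𝓥 τ₁ T₁ κ σ H F X τ T B) :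
    PairKernelCertS 𝓘 𝓑 𝓥 τ₁ T₁ κ σ H F X τ T B :=
  fun M z c M₀ z₀ c₀ e hch hb hP => h M z c M₀ z₀ c₀ e hch (hle M z c M₀ z₀ c₀ e hb) hP

/-- (P) is MONOTONE in the mode family. [formal bookkeeping] -/
theorem PairKernelCertS.mono_modes (h : PairKernelCertS 𝓘 𝓑 𝓥 τ₁ T₁ κ σ H F X τ T B) (hle : ModesLE 𝓥 𝓥') :
    PairKernelCertS 𝓘 𝓑 𝓥' τ₁ T₁ κ σ H F X τ T B := by
  intro M z c M₀ z₀ c₀ e hch hb hP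
  obtain ⟨v, hv, hchS⟩ := h M z c M₀ z₀ c₀ e hch hb hP
  exact ⟨v, hle M₀ z₀ c₀ v hv, hchS⟩

/-- (P₀) is (P) at `zeroModes`. [formal bookkeeping] -/
theorem pairKernelCertS_zeroModes_iff :
    PairKernelCertS 𝓘 𝓑 zeroModes τ₁ T₁ κ σ H F X τ T B ↔ PairKernelCert 𝓘 𝓑 τ₁ T₁ κ σ H F X τ T B := by
  constructor
  · intro h M z c M₀ z₀ c₀ e hch hb hP
    obtain ⟨v, hv, hchS⟩ := h M z c M₀ z₀ c₀ e hch hb hP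
    have hv0 : v = 0 := hv
    subst hv0
    exact chartByGBS_zero_iff.1 hchS
  · intro h M z c M₀ z₀ c₀ e hch hb hP
    exact ⟨0, rfl, chartByGBS_zero_iff.2 (h M z c M₀ z₀ c₀ e hch hb hP)⟩

/-- (P₀) gives (P) for every mode family containing the zero field. [formal bookkeeping] -/
theorem pairKernelCertS_of_pairKernelCert (h0 : ZeroMem 𝓥) (h : PairKernelCert 𝓘 𝓑 τ₁ T₁ κ σ H F X τ T B) :
    PairKernelCertS 𝓘 𝓑 𝓥 τ₁ T₁ κ σ H F X τ T B :=
  (pairKernelCertS_zeroModes_iff.2 h).mono_modes (modesLE_zeroModes h0)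

/-- ★ (R) at no balance, a larger family and the same data is TRIVIAL (identity isometry, same host). [formal bookkeeping] -/
theorem balancedRefit_top (hle : FamilyLE 𝓘₀ 𝓘) : BalancedRefit 𝓘₀ 𝓘 balTop ρ ε η₂ τ₀ T₀ τ₀ T₀ := by
  intro M z c M₀ z₀ c₀ e _ _ _ _ _ hch
  refine ⟨LinearIsometryEquiv.refl ℝ E3, M₀, z₀, c₀, e, ?_, trivial⟩
  have hcomp : (⇑(LinearIsometryEquiv.refl ℝ E3) ∘ z) = z := funext fun _ => rfl
  rw [hcomp]
  exact hch.mono_family hle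

/-- (R) is MONOTONE in the balance it promises (less balance is easier). [formal bookkeeping] -/
theorem BalancedRefit.mono_bal (h : BalancedRefit 𝓘₀ 𝓘 𝓑 ρ ε η₂ τ₀ T₀ τ₁ T₁) (hle : BalLE 𝓑 𝓑') :
    BalancedRefit 𝓘₀ 𝓘 𝓑' ρ ε η₂ τ₀ T₀ τ₁ T₁ := by
  intro M z c M₀ z₀ c₀ e hz hcl hm hn hg hch
  obtain ⟨R, M₁, z₁, c₁, e₁, hch₁, hb⟩ := h M z c M₀ z₀ c₀ e hz hcl hm hn hg hch
  exact ⟨R, M₁, z₁, c₁, e₁, hch₁, hle M (⇑R ∘ z) c M₁ z₁ c₁ e₁ hb⟩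

/-- ★★★ **THE SEAM: (R) ∧ (E) ∧ (P) ⟹ (T) `RefineGBS 𝓘₀ 𝓘 𝓥 ρ ε η₂ τ₀ T₀ τ T B`** — balance the chart modulo an isometry, enclose its deviation field in the
inflated polytope (the cluster hypotheses are isometry-invariant: tree `admissible_comp_iff`, `cleanBall_comp_iff`, `monoPhaseBall_comp_iff`,
`nearHomIsoAt_comp_iff`, `goodAtScale_comp_iff`), certify the pair cones on the polytope.  Every family, balance, mode family, radius, tables. [folklore] -/
theorem refineGBS_of_kernelCut (hR : BalancedRefit 𝓘₀ 𝓘 𝓑 ρ ε η₂ τ₀ T₀ τ₁ T₁) (hE : SlavingEnclosureG 𝓘 𝓑 ρ ε η₂ τ₁ T₁ κ σ H F X)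
    (hP : PairKernelCertS 𝓘 𝓑 𝓥 τ₁ T₁ κ σ H F X τ T B) : RefineGBS 𝓘₀ 𝓘 𝓥 ρ ε η₂ τ₀ T₀ τ T B := by
  intro M z c M₀ z₀ c₀ e hz hcl hm hn hg hch
  obtain ⟨R, M₁, z₁, c₁, e₁, hch₁, hb⟩ := hR M z c M₀ z₀ c₀ e hz hcl hm hn hg hch
  have hP₁ := hE M (⇑R ∘ z) c M₁ z₁ c₁ e₁ ((admissible_comp_iff R z c).2 hz) ((cleanBall_comp_iff R z c).2 hcl)
    ((monoPhaseBall_comp_iff R z c).2 hm) (fun h => hn ((nearHomIsoAt_comp_iff R z c).1 h)) ((goodAtScale_comp_iff R z c).2 hg) hch₁ hb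
  obtain ⟨v, hv, hchS⟩ := hP M (⇑R ∘ z) c M₁ z₁ c₁ e₁ hch₁ hb hP₁
  exact ⟨R, M₁, z₁, c₁, e₁, v, hv, hchS⟩

/-- ★★★ **THE SEAM AT `zeroModes`: (R) ∧ (E) ∧ (P₀) ⟹ (D_GB) `RefineGB 𝓘₀ 𝓘 ρ ε η₂ τ₀ T₀ τ T B`.** [folklore] -/
theorem refineGB_of_kernelCut (hR : BalancedRefit 𝓘₀ 𝓘 𝓑 ρ ε η₂ τ₀ T₀ τ₁ T₁) (hE : SlavingEnclosureG 𝓘 𝓑 ρ ε η₂ τ₁ T₁ κ σ H F X)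
    (hP : PairKernelCert 𝓘 𝓑 τ₁ T₁ κ σ H F X τ T B) : RefineGB 𝓘₀ 𝓘 ρ ε η₂ τ₀ T₀ τ T B :=
  refineGBS_zeroModes_iff.1 (refineGBS_of_kernelCut hR hE (pairKernelCertS_zeroModes_iff.2 hP))

/-- ★★ THE A-PRIORI NODE: (R) ∧ (TFR-G κσ₁) ∧ (P) ⟹ (T), the enclosure discharged by the proved force cap. [folklore] -/
theorem refineGBS_of_kernelCut_taylor (hR : BalancedRefit 𝓘₀ 𝓘 𝓑 ρ ε η₂ τ₀ T₀ τ₁ T₁)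
    (hT : ForceTaylorBoundG 𝓘 𝓑 ρ ε η₂ τ₁ T₁ (κ * sigmaOne) H F X) (hP : PairKernelCertS 𝓘 𝓑 𝓥 τ₁ T₁ κ sigmaOne H F X τ T B) :
    RefineGBS 𝓘₀ 𝓘 𝓥 ρ ε η₂ τ₀ T₀ τ T B :=
  refineGBS_of_kernelCut hR (slavingEnclosureG_of_taylor hT) hP

end Seams

/-! ## §3. The radius-graded pair table (the repair pre-typed for BEND-86 / RIMLOOSE-86) -/

/-- ★ `rimCone RI β s βr sr τ₀` — on SCORE-RELEVANT host pairs (`|z₀ a − z₀ b| ≤ 9/2`, `min` host radius `≤ 2`): the record cone `β + s·ℓ` if BOTH endpoints lie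
within `RI` of the host centre (INNER pairs), the rim cone `βr + sr·ℓ` otherwise (pairs touching the collar); the dipole value `2τ₀` on irrelevant pairs. -/
noncomputable def rimCone (RI β s βr sr τ₀ : ℝ) : PairTab := fun _ z₀ c₀ a b =>
  if dist (z₀ a) (z₀ b) ≤ 9 / 2 ∧ min (dist (z₀ a) (z₀ c₀)) (dist (z₀ b) (z₀ c₀)) ≤ 2 then
    (if max (dist (z₀ a) (z₀ c₀)) (dist (z₀ b) (z₀ c₀)) ≤ RI then β + s * dist (z₀ a) (z₀ b) else βr + sr * dist (z₀ a) (z₀ b))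
  else 2 * τ₀

/-- ★ `rimConeBy RI βf sf βr sr τ₀` — the same with all four cone parameters READ OFF THE HOST (host-graded, like `relConeBy`). -/
noncomputable def rimConeBy (RI : ℝ) (βf sf βr sr : (M₀ : ℕ) → (Fin M₀ → E3) → Fin M₀ → ℝ) (τ₀ : ℝ) : PairTab :=
  fun M₀ z₀ c₀ a b => rimCone RI (βf M₀ z₀ c₀) (sf M₀ z₀ c₀) (βr M₀ z₀ c₀) (sr M₀ z₀ c₀) τ₀ M₀ z₀ c₀ a b

section RimCone

variable {RI τ₀ : ℝ} {βf sf βr sr : (M₀ : ℕ) → (Fin M₀ → E3) → Fin M₀ → ℝ}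

/-- With the rim cone EQUAL to the record cone the radius-graded table IS `relConeBy`. [formal bookkeeping] -/
theorem rimConeBy_self (RI : ℝ) (βf sf : (M₀ : ℕ) → (Fin M₀ → E3) → Fin M₀ → ℝ) (τ₀ : ℝ) : rimConeBy RI βf sf βf sf τ₀ = relConeBy 2 βf sf τ₀ := by
  funext M₀ z₀ c₀ a b
  unfold rimConeBy rimCone relConeBy relCone
  split_ifs <;> rfl

/-- ★ The record table lies BELOW the radius-graded one whenever the rim cone dominates the record cone (`βf ≤ βr`, `sf ≤ sr`): so (D_GB) at `relConeBy` gives (D_GB)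
at `rimConeBy` (`RefineGB.mono`) and an E-cell at `rimConeBy` gives the E-cell at `relConeBy` (`TubeFloorGB.anti_pair`). [formal bookkeeping] -/
theorem pairLE_relConeBy_rimConeBy (hβ : ∀ (M₀ : ℕ) (z₀ : Fin M₀ → E3) (c₀ : Fin M₀), βf M₀ z₀ c₀ ≤ βr M₀ z₀ c₀)
    (hs : ∀ (M₀ : ℕ) (z₀ : Fin M₀ → E3) (c₀ : Fin M₀), sf M₀ z₀ c₀ ≤ sr M₀ z₀ c₀) :
    PairLE (relConeBy 2 βf sf τ₀) (rimConeBy RI βf sf βr sr τ₀) := by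
  intro M₀ z₀ c₀ a b
  unfold rimConeBy rimCone relConeBy relCone
  by_cases hrel : dist (z₀ a) (z₀ b) ≤ 9 / 2 ∧ min (dist (z₀ a) (z₀ c₀)) (dist (z₀ b) (z₀ c₀)) ≤ 2
  · rw [if_pos hrel, if_pos hrel]
    by_cases hin : max (dist (z₀ a) (z₀ c₀)) (dist (z₀ b) (z₀ c₀)) ≤ RI
    · rw [if_pos hin]
    · rw [if_neg hin]
      have h₁ := hβ M₀ z₀ c₀
      have h₂ := mul_le_mul_of_nonneg_right (hs M₀ z₀ c₀) (dist_nonneg : 0 ≤ dist (z₀ a) (z₀ b))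
      linarith
  · rw [if_neg hrel, if_neg hrel]

end RimCone

end Summit.AtomisticToContinuum.Crystallization.Theorems.FrustratedLawDichotomyStrainedPatchKernelCut
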